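import Literature.MathematicalPhysics.QuantumFieldTheory.Balaban1983to89.B15Ineq137Local
import Literature.MathematicalPhysics.QuantumFieldTheory.Balaban1983to89.B15HDecayLeaves
import Literature.MathematicalPhysics.QuantumFieldTheory.Balaban1983to89.B15GammaSmallness
import Literature.MathematicalPhysics.QuantumFieldTheory.Balaban1983to89.B15SmallField185

/-!
# `Balaban1983to89.B15Ineq139From190` — [Balaban1989LargeFieldI] p. 185, the sentence before (1.39): *"We assume that it
# [γ] is so small that the expression on the left-hand side of (1.37) can be bounded by ½δ_j"* — ON THE LATTICE MODEL,
# END-TO-END FROM [15] (190): p29's (1.37) with the printed local supremum (`B15Ineq137Local.ineq137_local`) × the (1.38)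
# chain with its first member DERIVED from (190) (`B15HDecayLeaves.ineq138_first_of_ineq190`, b01/r12's `ineq138_middle`,
# `eq138_last`) × the γ-clause (`B15GammaSmallness.ineq137_half_of_gamma`)

statement-level skeleton of published theorems with citation tags; proofs where landed; nothing here is a claim about
the Yang–Mills mass gap.

CITATION HEADER (lean-in-tree rule 2026-08-18).  T. Bałaban, *Large field renormalization. I. The basic step of the 𝐑
operation*, Commun. Math. Phys. **122**, 175–202 (1989), doi:10.1007/BF01257412, bib `Balaban1989LargeFieldI` (cell paper
B15; PDF held `paper:balaban1989-cmp122-large-field-i`; pp. 184–185 = PDF 10–11, OCR `p0010.txt`/`p0011.txt` + x2 renders).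
"[15]" = [Balaban1985Variational] (190) p. 308 (`B11SectG.Ineq190`); "[3]" = [Balaban1984PropagatorsII] (2.61)
(`B11SectG.RowSum`); "[12]" = [Balaban1985Averaging] (106)–(108)/(159)–(166); "[III]" = [Balaban1988Convergent] (2.4)/(2.5)
(`logPow`, `B14.IsRj`).  WHAT IS REPRODUCED: SKELETON rows `B15.Eq1.37`/`B15.Eq1.38`/`B15.Eq1.39` (the ½δ_j sentence), unit
`lit-balaban-r12` gen 8, HOME `run/shared/lean/pub/lit-balaban/` (`lit-balaban-r12/ROWS-B15.md`).  KNITTING — used BY NAME,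
nothing restated: `B15Ineq137Local.ineq137_local` (p29 g6), `B15HDecayLeaves.ineq138_first_of_ineq190` (r12 g8),
`B15SmallField185.ineq138_middle`/`eq138_last` (r12 g7), `B15GammaSmallness.ineq137_half_of_gamma` (r12 g8).

THE PRINTED TEXT (pp. 184–185, verbatim): *"|exp iℍ^{(j)}(b) − 1| ≦ O(1)L sup|ℍ|. (1.37) … |ℍ| < B₃(4δ′_j + exp(−δMR_{j+1})
22d²ε_{j+1} + exp(−δ6LMR_{j+1})22d²ε_j) ≦ B₃(4δ′_j + exp(−δMR_{j+1})44d²(1 + β₀)ε_j) = B₃(4p₁(g_j)/p₀(g_j) + exp(−δMR_{j+1})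
44d²(1 + β₀)A₀/A₁)δ_j on □′^{∼2} … (1.38) The quotient on the right-hand side of the last equality is a negative power of
log g_j⁻², hence the coefficient at δ_j can be arbitrarily small for γ sufficiently small. We assume that it is so small that
the expression on the left-hand side of (1.37) can be bounded by ½δ_j."*

WHAT THIS FILE PROVES (kernel-checked, zero `sorry`; no `def`, no new `Prop`, no new named fact; axioms standard).
* `ineq139_half_lattice_of_ineq190_gamma` — for p29's lattice expression of the left-hand side of (1.37) (regime (M2),
  gauge fixing `glev`, level `j`): `|exp iℍ^{(j)}(b) − 1| ≤ ½δ_j`, from: (190) for the block size `bout` at the base point `y`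
  with the THREE localised pieces of (1.38) (argument field `≤ 4δ′_j` anywhere, `≤ 22d²ε_{j+1}` at distance `≥ MR`,
  `≤ 22d²ε_j` at distance `≥ 6LMR`, `R = R_{j+1}`; (2.61) at rate `σ`, `σ + τ ≤ ⅛δ₀`; `Cκ_Bc < B₃`; mean-value domination)
  ⇒ (1.38)₁ with decay rate `τ`; the dictionary `hdom` (block size dominates `‖ℍ(y′,μ)‖` on `B^j(b₋) ∪ B^j(b₊)`); p29's
  `ineq137_local` (dev `≤ (136(d+1)+320d)·sup`, its located `s`-conditions at `s = bout.loc y ℍB`); (1.38)₂ (`ε_{j+1} ≤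
  (1+2β₀)ε_j`, `6L ≥ 1`); (1.38)₃ (the letters `δ′_j = g_jA₁p₁(g_j)`, `ε_j = g_jA₀p₀(g_j)`, `δ_j = g_jA₁p₀(g_j)`); and the
  γ-clause `(136(d+1)+320d)·B₃(4(log γ⁻²)⁻¹ + 44d²(1+β₀)(A₀/A₁)γ²) ≤ ½` ((2.5) for `R_{j+1}`, `0 < g_j, g_{j+1} ≤ γ`,
  `log γ⁻² ≥ 1`, `τM ≥ 1`, `p₁ < p₀`, signs).
* §2 (v1.1) `ineq139_half_lattice_of_ineq190_gamma'` — the same with p29's four located `s`-conditions DERIVED (s ≤ δ_j/(2·(136(d+1)+320d))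
  by (1.38) from (190) + the γ-clause, δ_j ≤ A₁(4p₀)^{p₀}√γ) from three explicit clauses in γ and the (52)-parameter `α₀`.
HONEST SCOPE.  (190), the dictionary and (v1: p29's located side conditions) are hypotheses; the (1.38) decay rate is identified
with the (190)/(2.61) rate `τ`.  NOT summit progress.
-/

open NormedSpace Finset

namespace Literature.MathematicalPhysics.QuantumFieldTheory.Balaban1983to89.B15Ineq139From190

open Literature.MathematicalPhysics.QuantumFieldTheory.Balaban1983to89
open B7Prop1Explicit B7Prop2Explicit B7Prop3Flat B7Eq92Concrete B7Eq99Concrete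
open B11SectG B15.PrelimIntegrations B15.Ineq194Flow B15HDecayLeaves B15GammaSmallness B15Ineq137Local B15SmallField185

/-- **p. 185, «the left-hand side of (1.37) can be bounded by ½δ_j», ON THE LATTICE MODEL, FROM [15] (190) AND γ**
(`ineq137_local` × (`ineq138_first_of_ineq190`, `ineq138_middle`, `eq138_last`) × `ineq137_half_of_gamma`).
[cite: Balaban1989LargeFieldI, (1.37)–(1.39) pp.184–185; Balaban1985Variational, (190) p.308] -/
theorem ineq139_half_lattice_of_ineq190_gamma
    -- [15]'s block-majorant data, three pieces (1.38)
    {gB : B6.Geometry} {FB FA : Type} [AddCommGroup FB] [Module ℝ FB] [AddCommGroup FA] [Module ℝ FA]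
    {T : Type*} {bB : BlockNorm gB FB} {bout : BlockNorm gB FA} {dH : T → FB →ₗ[ℝ] FA} {C δ₀ σ τ c : ℝ}
    (h190 : ∀ t, Ineq190 bB bout (dH t) C δ₀) (hC : 0 ≤ C) (hd : ∀ a b : gB.Site, 0 ≤ gB.dist a b)
    (hrow : RowSum gB σ c) (hτ : 0 ≤ τ) (hστ : σ + τ ≤ δ₀ / 8) {B₁ B₂ B₃p : FB} (y : gB.Site)
    -- the lattice data (p29)
    {d : ℕ} {𝔸 : Type*} [NormedRing 𝔸] [NormedAlgebra ℂ 𝔸] [CompleteSpace 𝔸] [NormOneClass 𝔸]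
    {L : ℕ} (hL : 2 ≤ L) {G : Subgroup 𝔸ˣ} (hG : AvgClosed d L G) {j : ℕ}
    {U₀ : B7Prop1Explicit.Site d → Fin d → 𝔸ˣ} (hU₀ : ∀ x κ, U₀ x κ ∈ G) {α₀ : ℝ} (hα : 0 < α₀)
    (hα3 : C0 d * α₀ ≤ 1 / 3) (hα4 : 4 * α₀ ≤ c2' d L) (h52 : pdev U₀ < α₀ * (((L : ℝ) ^ j)⁻¹) ^ 2)
    (H : B7Prop1Explicit.Site d → Fin d → 𝔸) (q : B7Prop1Explicit.Site d) (κ : Fin d)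
    {B₃ δ'j M εj εj1 β₀ A₀ A₁ δj γ gj gj1 : ℝ} {R r p₀ p₁ : ℕ}
    (hm₁ : ∀ y', bB.loc y' B₁ ≤ 4 * δ'j) (hD₁ : ∀ y', bB.loc y' B₁ ≠ 0 → 0 ≤ gB.dist y y')
    (hm₂ : ∀ y', bB.loc y' B₂ ≤ 22 * (d : ℝ) ^ 2 * εj1) (hD₂ : ∀ y', bB.loc y' B₂ ≠ 0 → M * R ≤ gB.dist y y')
    (hm₃ : ∀ y', bB.loc y' B₃p ≤ 22 * (d : ℝ) ^ 2 * εj)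
    (hD₃ : ∀ y', bB.loc y' B₃p ≠ 0 → 6 * (L : ℝ) * M * R ≤ gB.dist y y')
    {HB : FA} (hmv : ∀ s : ℝ, (∀ t, bout.loc y (dH t (B₁ + B₂ + B₃p)) ≤ s) → bout.loc y HB ≤ s)
    (hδ'j : 0 < δ'j) (hε : 0 ≤ εj) (hε1 : 0 ≤ εj1) (hCB : C * bB.κ * c < B₃) (hB₃ : 0 ≤ B₃)
    -- the dictionary
    (hdom : ∀ y' μ, B7Prop1Local.InBox (B7Prop1Local.loK L j q) (B7Prop1Local.bondHiK L j q κ) y' →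
      ‖H y' μ‖ ≤ bout.loc y HB)
    -- p29's located `s`-conditions at `s = bout.loc y ℍB`
    (hsmall : Real.exp (4 * (800 * ((d : ℝ) + 1) ^ 2 * ((d : ℝ) + 4)) * α₀)
      * (1 + 8 * (131072 * ((d : ℝ) + 1) ^ 2) * bout.loc y HB) ≤ 2)
    (hc₃ : 2 * bout.loc y HB ≤ c3 d L) (hsm : 2048 * (d : ℝ) * bout.loc y HB ≤ 1) (h1 : 128 * bout.loc y HB ≤ 1)
    (hL1 : 1 ≤ L)
    -- (1.38)₂,₃ data
    (hflow : εj1 ≤ (1 + 2 * β₀) * εj) (hA₁ : A₁ ≠ 0) (hp₀v : logPow p₀ gj ≠ 0)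
    (hδ' : δ'j = gj * A₁ * logPow p₁ gj) (hεj : εj = gj * A₀ * logPow p₀ gj) (hδj : δj = gj * A₁ * logPow p₀ gj)
    -- γ data
    (hr : 1 ≤ r) (hp : p₁ < p₀) (hgj : 0 < gj) (hgjγ : gj ≤ γ) (hR : B14.IsRj L r gj1 R) (hgj1 : 0 < gj1)
    (hgj1γ : gj1 ≤ γ) (hγe : 1 ≤ Real.log (γ ^ 2)⁻¹) (hτM : 1 ≤ τ * M)
    (hK : 0 ≤ 44 * (d : ℝ) ^ 2 * (1 + β₀) * (A₀ / A₁)) (hδj0 : 0 ≤ δj)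
    (hγ : (136 * ((d : ℝ) + 1) + 320 * d) * B₃
      * (4 * (Real.log (γ ^ 2)⁻¹)⁻¹ + 44 * (d : ℝ) ^ 2 * (1 + β₀) * (A₀ / A₁) * γ ^ 2) ≤ 1 / 2) :
    ‖((avgIter L
          (gaugeAct (B7Eq84Concrete.glev L hL1 U₀
              (expCfg (fun y μ => ((Complex.I : ℂ) * ((((L : ℝ) ^ j)⁻¹ : ℝ) : ℂ)) • H y μ)) j 0)⁻¹
            (expCfg (fun y μ => ((Complex.I : ℂ) * ((((L : ℝ) ^ j)⁻¹ : ℝ) : ℂ)) • H y μ) * U₀)) j q κ : 𝔸ˣ) : 𝔸)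
        * (((avgIter L U₀ j q κ)⁻¹ : 𝔸ˣ) : 𝔸) - 1‖ ≤ δj / 2 := by
  set s := bout.loc y HB with hs
  have hs0 : 0 ≤ s := bout.loc_nonneg _ _
  -- (1.37), p29
  have h137 := (ineq137_local hL hG hU₀ hα hα3 hα4 h52 H q κ hs0 hdom hsmall hc₃ hsm h1 hL1).1
  -- (1.38)₁ from (190)
  have h138 := ineq138_first_of_ineq190 h190 hC hd hrow hτ hστ y hm₁ hD₁ hm₂ hD₂ hm₃ hD₃ hmv hδ'j hε hε1 hCB
  unfold Ineq138 at h138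
  have ha : 0 ≤ τ * M * R := by positivity -- `τ·M ≥ 1` (`hτM`), `R ∈ ℕ`
  have h6L : (1 : ℝ) ≤ 6 * L := by
    have : (2 : ℝ) ≤ L := by exact_mod_cast hL
    linarith
  -- (1.38)₂
  have hmid := ineq138_middle (δ' := δ'j) (d := (d : ℝ)) (a := τ * M * R) hB₃ ha h6L hε hflow
  have e1 : Real.exp (-(τ * 6 * L * M * R)) = Real.exp (-(6 * L * (τ * M * R))) := by ring_nf
  rw [e1] at h138
  -- (1.38)₃
  have hlast := eq138_last (B₃ := B₃) (a := τ * M * R) (d := (d : ℝ)) (β₀ := β₀) hA₁ hp₀v hδ' hεj hδj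
  -- the γ-clause
  have hγ' := ineq137_half_of_gamma (δ := τ) hr hp hgj hgjγ hR hgj1 hgj1γ hγe hτM (by positivity) hB₃ hK hγ
  -- assemble
  have hc0 : 0 ≤ 136 * ((d : ℝ) + 1) + 320 * d := by positivity
  have hsX : s ≤ B₃ * (4 * (logPow p₁ gj / logPow p₀ gj)
      + Real.exp (-(τ * M * R)) * (44 * (d : ℝ) ^ 2) * (1 + β₀) * (A₀ / A₁)) * δj := by
    rw [← hlast]; exact (h138.le.trans hmid)
  calc _ ≤ (136 * ((d : ℝ) + 1) + 320 * d) * s := h137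
    _ ≤ (136 * ((d : ℝ) + 1) + 320 * d) * (B₃ * (4 * (logPow p₁ gj / logPow p₀ gj)
          + Real.exp (-(τ * M * R)) * (44 * (d : ℝ) ^ 2) * (1 + β₀) * (A₀ / A₁)) * δj) :=
        mul_le_mul_of_nonneg_left hsX hc0
    _ = ((136 * ((d : ℝ) + 1) + 320 * d) * B₃ * (4 * (logPow p₁ gj / logPow p₀ gj)
          + Real.exp (-(τ * M * R)) * (44 * (d : ℝ) ^ 2) * (1 + β₀) * (A₀ / A₁))) * δj := by ring
    _ ≤ (1 / 2) * δj := mul_le_mul_of_nonneg_right hγ' hδj0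
    _ = δj / 2 := by ring

/-! ## §2 (v1.1). The located `s`-conditions from γ -/

/-- Monotonicity of p29's four located `s`-conditions: they pass from a majorant `S ≥ s ≥ 0` to `s` (`d ≥ 1`). [folklore] -/
private theorem located_of_le {d L : ℕ} {s S α₀ : ℝ} (hd1 : 1 ≤ d) (hs0 : 0 ≤ s) (hle : s ≤ S)
    (hsmS : 2048 * (d : ℝ) * S ≤ 1) (hc₃S : 2 * S ≤ c3 d L)
    (hsmallS : Real.exp (4 * (800 * ((d : ℝ) + 1) ^ 2 * ((d : ℝ) + 4)) * α₀)
      * (1 + 8 * (131072 * ((d : ℝ) + 1) ^ 2) * S) ≤ 2) :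
    Real.exp (4 * (800 * ((d : ℝ) + 1) ^ 2 * ((d : ℝ) + 4)) * α₀) * (1 + 8 * (131072 * ((d : ℝ) + 1) ^ 2) * s) ≤ 2 ∧
    2 * s ≤ c3 d L ∧ 2048 * (d : ℝ) * s ≤ 1 ∧ 128 * s ≤ 1 := by
  have hd' : (1 : ℝ) ≤ d := by exact_mod_cast hd1
  have hexp : 0 ≤ Real.exp (4 * (800 * ((d : ℝ) + 1) ^ 2 * ((d : ℝ) + 4)) * α₀) := (Real.exp_pos _).le
  have hin : 1 + 8 * (131072 * ((d : ℝ) + 1) ^ 2) * s ≤ 1 + 8 * (131072 * ((d : ℝ) + 1) ^ 2) * S := by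
    have := mul_le_mul_of_nonneg_left hle (by positivity : (0 : ℝ) ≤ 8 * (131072 * ((d : ℝ) + 1) ^ 2))
    linarith
  have h3 := mul_le_mul_of_nonneg_left hle (by positivity : (0 : ℝ) ≤ 2048 * (d : ℝ))
  refine ⟨(mul_le_mul_of_nonneg_left hin hexp).trans hsmallS, by linarith, by linarith, ?_⟩
  have h2048 : 128 * s ≤ 2048 * (d : ℝ) * s := by nlinarith
  linarith

/-- **p. 185 «lhs of (1.37) ≤ ½δ_j», ON THE LATTICE, FROM [15] (190) AND γ — located side conditions from γ too**: as
`ineq139_half_lattice_of_ineq190_gamma`, with p29's four located `s`-conditions (at `s = bout.loc y ℍB`) DERIVED: by (1.38)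
from (190) and the γ-clause, `s ≤ δ_j/(2·(136(d+1)+320d))`, and `δ_j = g_jA₁(log g_j⁻²)^{p₀} ≤ A₁(4p₀)^{p₀}√γ`
(`B15GammaSmallness.mul_logPow_le_sqrt`, `p₀ ≥ 1`, `γ ≤ 1`), so three explicit clauses on
`S_γ = A₁(4p₀)^{p₀}√γ/(2·(136(d+1)+320d))` (in γ and the (52)-parameter `α₀`; `d ≥ 1`) suffice.
[cite: Balaban1989LargeFieldI, (1.37)–(1.39) pp.184–185; Balaban1988Convergent, (2.5) p.255] -/
theorem ineq139_half_lattice_of_ineq190_gamma'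
    -- [15]'s block-majorant data, three pieces (1.38)
    {gB : B6.Geometry} {FB FA : Type} [AddCommGroup FB] [Module ℝ FB] [AddCommGroup FA] [Module ℝ FA]
    {T : Type*} {bB : BlockNorm gB FB} {bout : BlockNorm gB FA} {dH : T → FB →ₗ[ℝ] FA} {C δ₀ σ τ c : ℝ}
    (h190 : ∀ t, Ineq190 bB bout (dH t) C δ₀) (hC : 0 ≤ C) (hd : ∀ a b : gB.Site, 0 ≤ gB.dist a b)
    (hrow : RowSum gB σ c) (hτ : 0 ≤ τ) (hστ : σ + τ ≤ δ₀ / 8) {B₁ B₂ B₃p : FB} (y : gB.Site)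
    -- the lattice data (p29)
    {d : ℕ} {𝔸 : Type*} [NormedRing 𝔸] [NormedAlgebra ℂ 𝔸] [CompleteSpace 𝔸] [NormOneClass 𝔸]
    {L : ℕ} (hL : 2 ≤ L) {G : Subgroup 𝔸ˣ} (hG : AvgClosed d L G) {j : ℕ}
    {U₀ : B7Prop1Explicit.Site d → Fin d → 𝔸ˣ} (hU₀ : ∀ x κ, U₀ x κ ∈ G) {α₀ : ℝ} (hα : 0 < α₀)
    (hα3 : C0 d * α₀ ≤ 1 / 3) (hα4 : 4 * α₀ ≤ c2' d L) (h52 : pdev U₀ < α₀ * (((L : ℝ) ^ j)⁻¹) ^ 2)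
    (H : B7Prop1Explicit.Site d → Fin d → 𝔸) (q : B7Prop1Explicit.Site d) (κ : Fin d)
    {B₃ δ'j M εj εj1 β₀ A₀ A₁ δj γ gj gj1 : ℝ} {R r p₀ p₁ : ℕ}
    (hm₁ : ∀ y', bB.loc y' B₁ ≤ 4 * δ'j) (hD₁ : ∀ y', bB.loc y' B₁ ≠ 0 → 0 ≤ gB.dist y y')
    (hm₂ : ∀ y', bB.loc y' B₂ ≤ 22 * (d : ℝ) ^ 2 * εj1) (hD₂ : ∀ y', bB.loc y' B₂ ≠ 0 → M * R ≤ gB.dist y y')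
    (hm₃ : ∀ y', bB.loc y' B₃p ≤ 22 * (d : ℝ) ^ 2 * εj)
    (hD₃ : ∀ y', bB.loc y' B₃p ≠ 0 → 6 * (L : ℝ) * M * R ≤ gB.dist y y')
    {HB : FA} (hmv : ∀ s : ℝ, (∀ t, bout.loc y (dH t (B₁ + B₂ + B₃p)) ≤ s) → bout.loc y HB ≤ s)
    (hδ'j : 0 < δ'j) (hε : 0 ≤ εj) (hε1 : 0 ≤ εj1) (hCB : C * bB.κ * c < B₃) (hB₃ : 0 ≤ B₃)
    -- the dictionary
    (hdom : ∀ y' μ, B7Prop1Local.InBox (B7Prop1Local.loK L j q) (B7Prop1Local.bondHiK L j q κ) y' →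
      ‖H y' μ‖ ≤ bout.loc y HB)
    (hL1 : 1 ≤ L)
    -- the located conditions in γ/α₀ form (`S_γ = A₁(4p₀)^{p₀}√γ / (2·(136(d+1)+320d))`)
    (hd1 : 1 ≤ d) (hA₁0 : 0 ≤ A₁) (hp₀1 : 1 ≤ p₀) (hγ1 : γ ≤ 1)
    (hsmγ : 2048 * (d : ℝ) * (A₁ * (4 * (p₀ : ℝ)) ^ p₀ * Real.sqrt γ / (2 * (136 * ((d : ℝ) + 1) + 320 * d))) ≤ 1)
    (hc₃γ : 2 * (A₁ * (4 * (p₀ : ℝ)) ^ p₀ * Real.sqrt γ / (2 * (136 * ((d : ℝ) + 1) + 320 * d))) ≤ c3 d L)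
    (hsmallγ : Real.exp (4 * (800 * ((d : ℝ) + 1) ^ 2 * ((d : ℝ) + 4)) * α₀)
      * (1 + 8 * (131072 * ((d : ℝ) + 1) ^ 2)
        * (A₁ * (4 * (p₀ : ℝ)) ^ p₀ * Real.sqrt γ / (2 * (136 * ((d : ℝ) + 1) + 320 * d)))) ≤ 2)
    -- (1.38)₂,₃ data
    (hflow : εj1 ≤ (1 + 2 * β₀) * εj) (hA₁ : A₁ ≠ 0) (hp₀v : logPow p₀ gj ≠ 0)
    (hδ' : δ'j = gj * A₁ * logPow p₁ gj) (hεj : εj = gj * A₀ * logPow p₀ gj) (hδj : δj = gj * A₁ * logPow p₀ gj)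
    -- γ data
    (hr : 1 ≤ r) (hp : p₁ < p₀) (hgj : 0 < gj) (hgjγ : gj ≤ γ) (hR : B14.IsRj L r gj1 R) (hgj1 : 0 < gj1)
    (hgj1γ : gj1 ≤ γ) (hγe : 1 ≤ Real.log (γ ^ 2)⁻¹) (hτM : 1 ≤ τ * M)
    (hK : 0 ≤ 44 * (d : ℝ) ^ 2 * (1 + β₀) * (A₀ / A₁)) (hδj0 : 0 ≤ δj)
    (hγ : (136 * ((d : ℝ) + 1) + 320 * d) * B₃
      * (4 * (Real.log (γ ^ 2)⁻¹)⁻¹ + 44 * (d : ℝ) ^ 2 * (1 + β₀) * (A₀ / A₁) * γ ^ 2) ≤ 1 / 2) :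
    ‖((avgIter L
          (gaugeAct (B7Eq84Concrete.glev L hL1 U₀
              (expCfg (fun y μ => ((Complex.I : ℂ) * ((((L : ℝ) ^ j)⁻¹ : ℝ) : ℂ)) • H y μ)) j 0)⁻¹
            (expCfg (fun y μ => ((Complex.I : ℂ) * ((((L : ℝ) ^ j)⁻¹ : ℝ) : ℂ)) • H y μ) * U₀)) j q κ : 𝔸ˣ) : 𝔸)
        * (((avgIter L U₀ j q κ)⁻¹ : 𝔸ˣ) : 𝔸) - 1‖ ≤ δj / 2 := by
  set s := bout.loc y HB with hs
  have hs0 : 0 ≤ s := bout.loc_nonneg _ _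
  -- (1.38)₁ from (190), (1.38)₂, (1.38)₃ and the γ-clause: s ≤ Q·δ_j with (136(d+1)+320d)·Q ≤ ½
  have h138 := ineq138_first_of_ineq190 h190 hC hd hrow hτ hστ y hm₁ hD₁ hm₂ hD₂ hm₃ hD₃ hmv hδ'j hε hε1 hCB
  unfold Ineq138 at h138
  have ha : 0 ≤ τ * M * R := by positivity
  have h6L : (1 : ℝ) ≤ 6 * L := by
    have : (2 : ℝ) ≤ L := by exact_mod_cast hL
    linarith
  have hmid := ineq138_middle (δ' := δ'j) (d := (d : ℝ)) (a := τ * M * R) hB₃ ha h6L hε hflow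
  have e1 : Real.exp (-(τ * 6 * L * M * R)) = Real.exp (-(6 * L * (τ * M * R))) := by ring_nf
  rw [e1] at h138
  have hlast := eq138_last (B₃ := B₃) (a := τ * M * R) (d := (d : ℝ)) (β₀ := β₀) hA₁ hp₀v hδ' hεj hδj
  have hγ' := ineq137_half_of_gamma (δ := τ) hr hp hgj hgjγ hR hgj1 hgj1γ hγe hτM (by positivity) hB₃ hK hγ
  have hc0 : (0 : ℝ) < 136 * ((d : ℝ) + 1) + 320 * d := by positivity
  have hsX : s ≤ B₃ * (4 * (logPow p₁ gj / logPow p₀ gj)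
      + Real.exp (-(τ * M * R)) * (44 * (d : ℝ) ^ 2) * (1 + β₀) * (A₀ / A₁)) * δj := by
    rw [← hlast]; exact (h138.le.trans hmid)
  -- hence (136(d+1)+320d)·s ≤ ½δ_j
  have hcs : (136 * ((d : ℝ) + 1) + 320 * d) * s ≤ 1 / 2 * δj :=
    calc (136 * ((d : ℝ) + 1) + 320 * d) * s
        ≤ (136 * ((d : ℝ) + 1) + 320 * d) * (B₃ * (4 * (logPow p₁ gj / logPow p₀ gj)
            + Real.exp (-(τ * M * R)) * (44 * (d : ℝ) ^ 2) * (1 + β₀) * (A₀ / A₁)) * δj) :=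
          mul_le_mul_of_nonneg_left hsX hc0.le
      _ = ((136 * ((d : ℝ) + 1) + 320 * d) * B₃ * (4 * (logPow p₁ gj / logPow p₀ gj)
            + Real.exp (-(τ * M * R)) * (44 * (d : ℝ) ^ 2) * (1 + β₀) * (A₀ / A₁))) * δj := by ring
      _ ≤ 1 / 2 * δj := mul_le_mul_of_nonneg_right hγ' hδj0
  -- δ_j ≤ A₁(4p₀)^{p₀}√γ
  have hγpos : 0 < γ := hgj.trans_le hgjγ
  have hδjle : δj ≤ A₁ * (4 * (p₀ : ℝ)) ^ p₀ * Real.sqrt γ := by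
    have h1 := mul_logPow_le_sqrt hgj (hgjγ.trans hγ1) hp₀1
    have h2 : Real.sqrt gj ≤ Real.sqrt γ := Real.sqrt_le_sqrt hgjγ
    have h3 : gj * logPow p₀ gj ≤ (4 * (p₀ : ℝ)) ^ p₀ * Real.sqrt γ :=
      h1.trans (mul_le_mul_of_nonneg_left h2 (by positivity))
    calc δj = A₁ * (gj * logPow p₀ gj) := by rw [hδj]; ring
      _ ≤ A₁ * ((4 * (p₀ : ℝ)) ^ p₀ * Real.sqrt γ) := mul_le_mul_of_nonneg_left h3 hA₁0
      _ = A₁ * (4 * (p₀ : ℝ)) ^ p₀ * Real.sqrt γ := by ring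
  have hle : s ≤ A₁ * (4 * (p₀ : ℝ)) ^ p₀ * Real.sqrt γ / (2 * (136 * ((d : ℝ) + 1) + 320 * d)) := by
    rw [le_div_iff₀ (by positivity)]
    have e2 : s * (2 * (136 * ((d : ℝ) + 1) + 320 * d)) = 2 * ((136 * ((d : ℝ) + 1) + 320 * d) * s) := by ring
    rw [e2]
    linarith [hcs, hδjle]
  obtain ⟨hsmall, hc₃, hsm, h1⟩ := located_of_le (L := L) hd1 hs0 hle hsmγ hc₃γ hsmallγ
  exact ineq139_half_lattice_of_ineq190_gamma h190 hC hd hrow hτ hστ y hL hG hU₀ hα hα3 hα4 h52 H q κ hm₁ hD₁ hm₂ hD₂ hm₃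
    hD₃ hmv hδ'j hε hε1 hCB hB₃ hdom hsmall hc₃ hsm h1 hL1 hflow hA₁ hp₀v hδ' hεj hδj hr hp hgj hgjγ hR hgj1 hgj1γ hγe hτM hK
    hδj0 hγ

end Literature.MathematicalPhysics.QuantumFieldTheory.Balaban1983to89.B15Ineq139From190
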